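import Summits.BirchSwinnertonDyer.Rank1Residual.Additive.X3BranchLowerDescent
import Summits.BirchSwinnertonDyer.Rank1Residual.Additive.X4RankZeroQuadraticBranchLower
import Summits.BirchSwinnertonDyer.Rank1Residual.Additive.GordCharLeadingTermConsequences
import HarnessLib

/-!
# X3 on the semistable-twist locus, rank `0`: the END STATE from the `ω^{(p−1)/2}`-branch main
# conjecture of `E♭` — `BSDp` on X3♯(M) at every odd `p` (parity discharged), and on X3♯(G-ord) with
# the typed exact leading term REPLACED by Delbourgo 2002 (`p ≥ 5` Theorem (B); `p = 3`)
# (cell `b2b-bsdres`, team n1011, seat p12 (gen 2), OWNERS row T-c2x3 (v); sequel of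
# `X3BranchLowerDescent.lean`)

HONEST FRAMING (cell `b2b-bsdres`, run/shared/lean/b2b/bsd-rank1-residual/, verbatim in every
file): the goal of the cell is to DELETE the COMBINATION-SHAPED residual classes of the
Birch–Swinnerton-Dyer formula for ALL analytic-rank `≤ 1` elliptic curves over `ℚ` — "full BSD
formula for every rank `≤ 1` curve in class `C`" assembled STRICTLY from published theorems — so
that the rank-`≤ 1` remainder becomes exactly the CONSTRUCTION-SHAPED classes, which are TYPED
(missing-input `Prop`s), NOT attempted. This is not "finishing BSD". Team n1011 (RESIDUAL-MAP §I
N10 / N11, X3 = additive `p`, `E[p]` REDUCIBLE), seat `b2b-bsdres-n1011-p12` (gen 2), row T-c2x3 (v):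
research route on the CONSTRUCTION-SHAPED class X3; labels and marks UNCHANGED; nothing booked; NO
Literature fact minted. THEOREMS ONLY: compositions of the sibling `X3BranchLowerDescent.lean`
(§2: `∀` twist models `V`, `X3BranchMainConjectureAt V p` — or Greenberg–Vatsal on the branch ∧ the
analytic `μ = 0` bit ∧ Wuthrich Thm. 16 — ⟹ seat p07's `T = 0` inputs) with the team's class
consumers; every PUBLISHED named fact stays an explicit binder passed verbatim (`hW16` / `hW16m` /
`hWu`: the three typed readings of Wuthrich 2014 Thm. 16 already in the tree — half-eigen at `p`,
minus-eigen at `3`, component; `hDel98`/`hDelX` Delbourgo 1998 Prop. 4; `hDel` Delbourgo 2002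
Theorems (A)/(B), `hDel3` its `p = 3` form; `hPal` Pal 2012 Thm. 3.2 (`d > 0`); `hGZK`;
`hmod`/`hmodD`); the typed OPEN inputs are `hMC` / `hlam` (OUR conjectures), `hμ` (per-pair analytic
`μ`-certificate, census EVIDENCE via instrument I-10 — never a fact).

## What this file adds to `X3BranchLowerDescent.lean`

* §1 **X3♯(M) ∧ `r_an = 0`, every odd `p` in ONE statement** (the parity split `p ≡ 1 / 3 (mod 4)`
  discharged inside the proof, `p ≠ 2` being part of `ClassX3M`):
  `ClassX3M.bsdp_rankZero_of_forall_x3BranchMainConjecture`,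
  `ClassX3M.bsdp_rankZero_of_forall_x3BranchLambdaEq_of_muZero`.
* §2 **X3♯(G-ord) ∩ `I₀*` (`e = 2`)**: the branch main conjecture of every twist model gives the
  cyclotomic `T = 0` input `CycLowerLeadingTermAt W p` (seat p07's Birch + Pal transport
  `cycLowerLeadingTermAt_iff_chiBranchLower[Odd]_of_typeGOrd_of_semistabilityIndex_eq_two`):
  `ClassX3Gord.cycLowerLeadingTermAt_of_forall_x3BranchMainConjecture`; hence for `p ≥ 5`, `E`
  non-CM, OFF the anomalous rows, with Delbourgo 2002 Theorem (B) (`hDel`, additive-p2's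
  `ClassX3Gord.missingLowerBoundAt_rankZero_of_cycLower_of_nonAnomalous`) in place of the typed
  `ExactLeadingTermAt`: `Typed.MissingLowerBoundAt W p`
  (`ClassX3Gord.missingLowerBoundAt_rankZero_of_forall_x3BranchMainConjecture_of_nonAnomalous`) and,
  the upper half being the Wuthrich component chain (`hWu`, additive-p2's
  `ClassX3Gord.bsdp_rankZero_of_cycLower_of_wuthrichComponent`), **`BSDp W p`**
  (`ClassX3Gord.bsdp_rankZero_of_forall_x3BranchMainConjecture_of_nonAnomalous`,
  `ClassX3Gord.bsdp_rankZero_of_forall_x3BranchLambdaEq_of_muZero_of_nonAnomalous`).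
* §3 **X3♯(G-ord) at `p = 3`** (twist by `−3`; the additive (G)-ordinary defect at `3` is `2`
  automatically): the conjecture ⟹ `CycLowerLeadingTermAt W 3` (seat p07's
  `TypeGOrd.cycLowerLeadingTermAt_three_of_quadraticBranchLower`) ⟹ OFF the anomalous rows, non-CM,
  with Delbourgo 2002 at `3` (`hDel3`, n1011-p16's `GordThreeCycLowerCore.lean`):
  `Typed.MissingLowerBoundAt W 3` and — the upper half being additive-p1's minus-eigen Wuthrich
  chain at `3` (`hW16m`) — **`BSDp W 3`**
  (`ClassX3Gord.{cycLowerLeadingTermAt,missingLowerBoundAt,bsdp}_three_…_of_forall_x3Branch…`).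

Nothing here is a class theorem: X3 stays CONSTRUCTION-SHAPED. Kernel sentence (wording material for
§I N10/N11, no mark): on X3 ∩ SubSemistableTwist ∧ `r_an = 0` — X3♯(M) at every odd `p`, X3♯(G-ord,
`I₀*`) off the anomalous / CM rows at `p ≥ 5` and at `p = 3` — `BSD(E,p)` ⟸ Greenberg–Vatsal's
`λ`-computation on the branch `(p−1)/2` of `E♭` (TYPED, OPEN) + one analytic `μ`-certificate per
pair, everything else PUBLISHED.

References: [GreenbergVatsal2000] Thm. (1.3), p. 4; [Wuthrich2014] Thm. 16; [Delbourgo1998] Prop. 4;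
[Delbourgo2002] Theorems (A), (B) (p. 40); [Pal2012] Thm. 3.2; [MazurTateTeitelbaum1986Invent]
§I.13–I.14.
-/

noncomputable section

open scoped Classical MatrixGroups ModularForm

namespace Summit.BirchSwinnertonDyer.Rank1Residual.Additive

open CongruenceSubgroup WeierstrassCurve Literature.NumberTheory.EllipticCurves
  Literature.NumberTheory.EllipticCurves.ModularForms
  Literature.NumberTheory.EllipticCurves.Rank1Residual
  Literature.NumberTheory.EllipticCurves.Rank1Residual.Typed
  Literature.NumberTheory.GaloisRepresentations
  Summit.BirchSwinnertonDyer.Rank1Residual.AdditivePotMult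
  Summit.BirchSwinnertonDyer.Rank1Residual.Additive.X3Branch

variable {W : WeierstrassCurve ℚ} [W.IsElliptic] [W.IsGloballyMinimal] {p : ℕ} [hp : Fact p.Prime]

/-! ### §1 X3♯(M) ∧ `r_an = 0`: every odd `p`, parity discharged -/

/-- **X3♯(M) ∧ `r_an = 0`, EVERY odd `p`: the `ω^{(p−1)/2}`-branch main conjecture of every twist
model `E♭` ⟹ `BSDp E p`** — the parity-specific consumers of `X3BranchLowerDescent.lean` with the
split `p ≡ 1 / 3 (mod 4)` discharged (`p ≠ 2` is part of `ClassX3M`; `hPal` is used on the even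
branch only). [cite: Delbourgo1998, Prop. 4 (p. 144)] [cite: Wuthrich2014, Thm. 16 (p. 397)]
[cite: Pal2012, Thm. 3.2] -/
theorem ClassX3M.bsdp_rankZero_of_forall_x3BranchMainConjecture
    (hDel : Delbourgo1998.prop4_rankZero_pow_dvd_constantCoeff)
    (hDelX : Delbourgo1998.prop4_rankZero_constantCoeff_eq_unit_mul_of_potMult)
    (hPal : Pal2012.thm32_sqrt_mul_realPeriodRat_twist_eq_of_prime_one_mod_four)
    (hGZK : rank_eq_analyticRank_of_analyticRank_le_one) (hmod : hasEntireLFunction_rat)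
    (hmodD : nonempty_modularParametrizationData)
    (hW16 : Wuthrich2014.thm16_halfEigenCharIdeal_dvd_cyclotomicPrime)
    (hX : ClassX3M W p) (hr : W.analyticRank = 0)
    (hMC : ∀ (V : WeierstrassCurve ℚ) [V.IsElliptic] [V.IsGloballyMinimal],
      (∃ C : VariableChange ℚ, C • V.quadraticTwist ((-1) ^ (p / 2) * p : ℚ) = W) →
        X3BranchMainConjectureAt V p) :
    BSDp W p := by
  have hodd := hp.out.eq_two_or_odd'
  have hp2 := hX.p_ne_two
  by_cases hp4 : p % 4 = 1
  · exact ClassX3M.bsdp_rankZero_of_x3BranchMainConjecture hDel hDelX hPal hGZK hmod hmodD hW16 hX hp4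
      hr hMC
  · have hp4' : p % 4 = 3 := by
      rcases hodd with h | h
      · exact absurd h hp2
      · obtain ⟨k, hk⟩ := h; omega
    exact ClassX3M.bsdp_rankZero_of_x3BranchMainConjecture_odd hDel hDelX hGZK hmod hmodD hW16 hX hp4'
      hr hMC

/-- **THE ROW'S CONSUMER on X3♯(M) ∧ `r_an = 0`, EVERY odd `p`**: Wuthrich 2014 Thm. 16 ∧
Greenberg–Vatsal ON THE BRANCH for every twist model (TYPED, OPEN) ∧ the analytic `μ`-certificate
for every twist model ⟹ `BSDp E p`, the other inputs PUBLISHED.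
[cite: GreenbergVatsal2000, Thm. (1.3) and p. 4] [cite: Wuthrich2014, Thm. 16 (p. 397)]
[cite: Delbourgo1998, Prop. 4 (p. 144)] [cite: Pal2012, Thm. 3.2] -/
theorem ClassX3M.bsdp_rankZero_of_forall_x3BranchLambdaEq_of_muZero
    (hDel : Delbourgo1998.prop4_rankZero_pow_dvd_constantCoeff)
    (hDelX : Delbourgo1998.prop4_rankZero_constantCoeff_eq_unit_mul_of_potMult)
    (hPal : Pal2012.thm32_sqrt_mul_realPeriodRat_twist_eq_of_prime_one_mod_four)
    (hGZK : rank_eq_analyticRank_of_analyticRank_le_one) (hmod : hasEntireLFunction_rat)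
    (hmodD : nonempty_modularParametrizationData)
    (hW16 : Wuthrich2014.thm16_halfEigenCharIdeal_dvd_cyclotomicPrime)
    (hX : ClassX3M W p) (hr : W.analyticRank = 0)
    (hlam : ∀ (V : WeierstrassCurve ℚ) [V.IsElliptic] [V.IsGloballyMinimal],
      (∃ C : VariableChange ℚ, C • V.quadraticTwist ((-1) ^ (p / 2) * p : ℚ) = W) →
        X3BranchLambdaEqAt V p)
    (hμ : ∀ (V : WeierstrassCurve ℚ) [V.IsElliptic] [V.IsGloballyMinimal],
      (∃ C : VariableChange ℚ, C • V.quadraticTwist ((-1) ^ (p / 2) * p : ℚ) = W) →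
        X3BranchAnalyticMuZeroAt V p) :
    BSDp W p :=
  ClassX3M.bsdp_rankZero_of_forall_x3BranchMainConjecture hDel hDelX hPal hGZK hmod hmodD hW16 hX hr
    (X3Branch.forall_mainConjecture_of_forall_lambdaEq_of_muZero W p hW16 hlam hμ)

/-! ### §2 X3♯(G-ord) ∩ `I₀*`: the cyclotomic `T = 0` input, and `BSDp` off the anomalous rows (`p ≥ 5`) -/

/-- **X3♯(G-ord) ∩ `I₀*` (`e = 2`), `p` odd: the branch main conjecture of every twist model ⟹
`CycLowerLeadingTermAt W p`** (the team's cyclotomic `T = 0` lower input): the sibling's `T = 0`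
descent, then seat p07's Birch + Pal transport with the good ordinary twist model as datum
(`cycLowerLeadingTermAt_iff_chiBranchLower[Odd]_of_typeGOrd_of_semistabilityIndex_eq_two`; `hPal`
enters on the even branch only). [cite: Pal2012, Thm. 3.2] [cite: MazurTateTeitelbaum1986Invent, §I.13–I.14] -/
theorem ClassX3Gord.cycLowerLeadingTermAt_of_forall_x3BranchMainConjecture
    (hPal : Pal2012.thm32_sqrt_mul_realPeriodRat_twist_eq_of_prime_one_mod_four)
    (hmod : hasEntireLFunction_rat) (hmodD : nonempty_modularParametrizationData)
    (hX : ClassX3Gord W p) (hp2 : p ≠ 2) (he : semistabilityIndex W p = 2)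
    (hMC : ∀ (V : WeierstrassCurve ℚ) [V.IsElliptic] [V.IsGloballyMinimal],
      (∃ C : VariableChange ℚ, C • V.quadraticTwist ((-1) ^ (p / 2) * p : ℚ) = W) →
        X3BranchMainConjectureAt V p) :
    CycLowerLeadingTermAt W p := by
  have hodd := hp.out.eq_two_or_odd'
  by_cases hp4 : p % 4 = 1
  · exact (cycLowerLeadingTermAt_iff_chiBranchLower_of_typeGOrd_of_semistabilityIndex_eq_two W p hPal
      hmod hmodD hp4 hX.addv hX.typeGOrd he).mpr
      (X3Branch.chiBranchLowerLeadingTermAt_of_forall_mainConjecture W p hX.classX3.1 hMC)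
  · have hp4' : p % 4 = 3 := by
      rcases hodd with h | h
      · exact absurd h hp2
      · obtain ⟨k, hk⟩ := h; omega
    exact (cycLowerLeadingTermAt_iff_chiBranchLowerOdd_of_typeGOrd_of_semistabilityIndex_eq_two W p
      hmod hmodD hp4' hX.addv hX.typeGOrd he).mpr
      (X3Branch.chiBranchLowerLeadingTermOddAt_of_forall_mainConjecture W p hX.classX3.1 hMC)

/-- **X3♯(G-ord) ∩ `I₀*`, `p ≥ 5`, `r_an = 0`, `E` non-CM, OFF the anomalous rows: the branch main
conjecture of every twist model ⟹ `Typed.MissingLowerBoundAt W p` WITHOUT the typed exact leading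
term** — Delbourgo 2002 Theorem (B) (`hDel`, additive-p2's
`ClassX3Gord.missingLowerBoundAt_rankZero_of_cycLower_of_nonAnomalous`) supplies it on these rows.
[cite: Delbourgo2002, Theorem (B) (p. 40)] [cite: Pal2012, Thm. 3.2] -/
theorem ClassX3Gord.missingLowerBoundAt_rankZero_of_forall_x3BranchMainConjecture_of_nonAnomalous
    (hPal : Pal2012.thm32_sqrt_mul_realPeriodRat_twist_eq_of_prime_one_mod_four)
    (hDel : Delbourgo2002.mainTheorem)
    (hGZK : rank_eq_analyticRank_of_analyticRank_le_one) (hmod : hasEntireLFunction_rat)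
    (hmodD : nonempty_modularParametrizationData)
    (hX : ClassX3Gord W p) (hcm : ¬ W.HasCM) (hp5 : 5 ≤ p) (he : semistabilityIndex W p = 2)
    (hr : W.analyticRank = 0) (hna : Delbourgo2002.ReductionNonAnomalous W p)
    (hMC : ∀ (V : WeierstrassCurve ℚ) [V.IsElliptic] [V.IsGloballyMinimal],
      (∃ C : VariableChange ℚ, C • V.quadraticTwist ((-1) ^ (p / 2) * p : ℚ) = W) →
        X3BranchMainConjectureAt V p) :
    MissingLowerBoundAt W p :=
  ClassX3Gord.missingLowerBoundAt_rankZero_of_cycLower_of_nonAnomalous hDel hGZK hmod hX hcm hp5 hr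
    (ClassX3Gord.cycLowerLeadingTermAt_of_forall_x3BranchMainConjecture hPal hmod hmodD hX (by omega) he
      hMC) hna

/-- **X3♯(G-ord) ∩ `I₀*`, `p ≥ 5`, `r_an = 0`, `E` non-CM, OFF the anomalous rows: the branch main
conjecture of every twist model ⟹ `BSDp W p`** — the upper half being the Wuthrich component chain
(`hWu`, additive-p2's `ClassX3Gord.bsdp_rankZero_of_cycLower_of_wuthrichComponent` with Delbourgo
1998 Prop. 4 `hDel98`), the lower leading term Delbourgo 2002 Theorem (B) `hDel`. No typed exact
input, no image / Tamagawa / Manin / `#Ш_an` hypothesis. NOT a class theorem (`hMC`).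
[cite: Delbourgo2002, Theorem (B) (p. 40)] [cite: Wuthrich2014, Thm. 16 (p. 397)]
[cite: Delbourgo1998, Prop. 4 (p. 144)] [cite: Pal2012, Thm. 3.2] -/
theorem ClassX3Gord.bsdp_rankZero_of_forall_x3BranchMainConjecture_of_nonAnomalous
    (hWu : Wuthrich2014.charIdeal_dvd_padicLFunctionBranch_component)
    (hPal : Pal2012.thm32_sqrt_mul_realPeriodRat_twist_eq_of_prime_one_mod_four)
    (hDel98 : Delbourgo1998.prop4_rankZero_pow_dvd_constantCoeff) (hDel : Delbourgo2002.mainTheorem)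
    (hGZK : rank_eq_analyticRank_of_analyticRank_le_one) (hmod : hasEntireLFunction_rat)
    (hmodD : nonempty_modularParametrizationData)
    (hX : ClassX3Gord W p) (hcm : ¬ W.HasCM) (hp5 : 5 ≤ p) (he : semistabilityIndex W p = 2)
    (hr : W.analyticRank = 0) (hna : Delbourgo2002.ReductionNonAnomalous W p)
    (hMC : ∀ (V : WeierstrassCurve ℚ) [V.IsElliptic] [V.IsGloballyMinimal],
      (∃ C : VariableChange ℚ, C • V.quadraticTwist ((-1) ^ (p / 2) * p : ℚ) = W) →
        X3BranchMainConjectureAt V p) :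
    BSDp W p :=
  ClassX3Gord.bsdp_rankZero_of_cycLower_of_wuthrichComponent hWu hPal hDel98 hDel hGZK hmod hmodD hX hcm
    hp5 he hr
    (ClassX3Gord.cycLowerLeadingTermAt_of_forall_x3BranchMainConjecture hPal hmod hmodD hX (by omega) he
      hMC) hna

/-- **THE ROW'S CONSUMER on X3♯(G-ord) ∩ `I₀*`, `p ≥ 5`, `r_an = 0`, non-CM, non-anomalous**:
Wuthrich 2014 Thm. 16 (half-eigen `hW16` and component `hWu` readings) ∧ Greenberg–Vatsal ON THE
BRANCH for every twist model (TYPED, OPEN) ∧ the analytic `μ`-certificate for every twist model ⟹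
`BSDp W p`, everything else PUBLISHED (`hPal hDel98 hDel hGZK hmod hmodD`).
[cite: GreenbergVatsal2000, Thm. (1.3) and p. 4] [cite: Wuthrich2014, Thm. 16 (p. 397)]
[cite: Delbourgo2002, Theorem (B) (p. 40)] [cite: Delbourgo1998, Prop. 4 (p. 144)] -/
theorem ClassX3Gord.bsdp_rankZero_of_forall_x3BranchLambdaEq_of_muZero_of_nonAnomalous
    (hW16 : Wuthrich2014.thm16_halfEigenCharIdeal_dvd_cyclotomicPrime)
    (hWu : Wuthrich2014.charIdeal_dvd_padicLFunctionBranch_component)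
    (hPal : Pal2012.thm32_sqrt_mul_realPeriodRat_twist_eq_of_prime_one_mod_four)
    (hDel98 : Delbourgo1998.prop4_rankZero_pow_dvd_constantCoeff) (hDel : Delbourgo2002.mainTheorem)
    (hGZK : rank_eq_analyticRank_of_analyticRank_le_one) (hmod : hasEntireLFunction_rat)
    (hmodD : nonempty_modularParametrizationData)
    (hX : ClassX3Gord W p) (hcm : ¬ W.HasCM) (hp5 : 5 ≤ p) (he : semistabilityIndex W p = 2)
    (hr : W.analyticRank = 0) (hna : Delbourgo2002.ReductionNonAnomalous W p)
    (hlam : ∀ (V : WeierstrassCurve ℚ) [V.IsElliptic] [V.IsGloballyMinimal],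
      (∃ C : VariableChange ℚ, C • V.quadraticTwist ((-1) ^ (p / 2) * p : ℚ) = W) →
        X3BranchLambdaEqAt V p)
    (hμ : ∀ (V : WeierstrassCurve ℚ) [V.IsElliptic] [V.IsGloballyMinimal],
      (∃ C : VariableChange ℚ, C • V.quadraticTwist ((-1) ^ (p / 2) * p : ℚ) = W) →
        X3BranchAnalyticMuZeroAt V p) :
    BSDp W p :=
  ClassX3Gord.bsdp_rankZero_of_forall_x3BranchMainConjecture_of_nonAnomalous hWu hPal hDel98 hDel hGZK
    hmod hmodD hX hcm hp5 he hr hna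
    (X3Branch.forall_mainConjecture_of_forall_lambdaEq_of_muZero W p hW16 hlam hμ)

/-! ### §3 X3♯(G-ord) at `p = 3` (twist by `−3`; defect `2` automatic) -/

/-- **X3♯(G-ord) at `3`: the `ω`-branch main conjecture of every twist model `E♭ = E ⊗ χ_{−3}` ⟹
`CycLowerLeadingTermAt W 3`** — the sibling's Λ-bridge (`V[3]` reducible with `E[3]`) into seat
p07's `TypeGOrd.cycLowerLeadingTermAt_three_of_quadraticBranchLower` (odd branch; Pal for `d < 0`
is a tree theorem; the additive (G)-ordinary defect at `3` is `2`). The twist is spelled with the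
literal `-3`. [cite: Pal2012, Thm. 3.2] [cite: MazurTateTeitelbaum1986Invent, §I.13–I.14] -/
theorem ClassX3Gord.cycLowerLeadingTermAt_three_of_forall_x3BranchMainConjecture [Fact (Nat.Prime 3)]
    (hmod : hasEntireLFunction_rat) (hmodD : nonempty_modularParametrizationData)
    (hX : ClassX3Gord W 3)
    (hMC : ∀ (V : WeierstrassCurve ℚ) [V.IsElliptic] [V.IsGloballyMinimal],
      (∃ C : VariableChange ℚ, C • V.quadraticTwist (-3 : ℚ) = W) → X3BranchMainConjectureAt V 3) :
    CycLowerLeadingTermAt W 3 := by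
  refine TypeGOrd.cycLowerLeadingTermAt_three_of_quadraticBranchLower hmod hmodD hX.typeGOrd hX.addv
    fun V _ _ hVW ↦ ?_
  exact X3Branch.quadraticBranchLowerDivisibilityAt_of_mainConjecture
    (fun hV ↦ hX.classX3.1 ((irr_iff_of_model_twist (W := V) (p := 3) (by norm_num) hVW).mpr hV))
    (hMC V hVW)

/-- **X3♯(G-ord) at `3`, `r_an = 0`, non-CM, OFF the anomalous rows: the branch main conjecture of
every twist model ⟹ `Typed.MissingLowerBoundAt W 3`** — Delbourgo 2002 at `p = 3` (`hDel3`,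
n1011-p16's `ClassX3Gord.missingLowerBoundAt_three_rankZero_of_cycLower_of_nonAnomalous`) supplies
the exact algebraic leading term. [cite: Delbourgo2002, Theorem (A), (B) (p. 40)] -/
theorem ClassX3Gord.missingLowerBoundAt_three_rankZero_of_forall_x3BranchMainConjecture_of_nonAnomalous
    [Fact (Nat.Prime 3)] (hDel3 : Delbourgo2002.mainTheorem_three)
    (hGZK : rank_eq_analyticRank_of_analyticRank_le_one) (hmod : hasEntireLFunction_rat)
    (hmodD : nonempty_modularParametrizationData)
    (hX : ClassX3Gord W 3) (hcm : ¬ W.HasCM) (hr : W.analyticRank = 0)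
    (hna : Delbourgo2002.ReductionNonAnomalous W 3)
    (hMC : ∀ (V : WeierstrassCurve ℚ) [V.IsElliptic] [V.IsGloballyMinimal],
      (∃ C : VariableChange ℚ, C • V.quadraticTwist (-3 : ℚ) = W) → X3BranchMainConjectureAt V 3) :
    MissingLowerBoundAt W 3 :=
  ClassX3Gord.missingLowerBoundAt_three_rankZero_of_cycLower_of_nonAnomalous hDel3 hGZK hmod hX hcm hr
    hna (ClassX3Gord.cycLowerLeadingTermAt_three_of_forall_x3BranchMainConjecture hmod hmodD hX hMC)

/-- **X3♯(G-ord) at `3`, `r_an = 0`, non-CM, OFF the anomalous rows: the branch main conjecture of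
every twist model ⟹ `BSDp W 3`** — n1011-p16's `ClassX3Gord.bsdp_three_rankZero_of_cycLower_of_nonAnomalous`
(lower: Delbourgo 2002 at `3`, `hDel3`; upper: additive-p1's minus-eigen Wuthrich chain at `3`,
`hW16m`, with Delbourgo 1998 Prop. 4 `hDel`). No typed exact input, no image hypothesis.
[cite: Delbourgo2002, Theorem (A), (B) (p. 40)] [cite: Wuthrich2014, Thm. 16 (p. 397)]
[cite: Delbourgo1998, Prop. 4 (p. 144)] -/
theorem ClassX3Gord.bsdp_three_rankZero_of_forall_x3BranchMainConjecture_of_nonAnomalous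
    [Fact (Nat.Prime 3)] (hDel3 : Delbourgo2002.mainTheorem_three)
    (hW16m : Wuthrich2014.thm16_minusEigenCharIdeal_dvd_cyclotomicThree)
    (hDel : Delbourgo1998.prop4_rankZero_pow_dvd_constantCoeff)
    (hGZK : rank_eq_analyticRank_of_analyticRank_le_one) (hmod : hasEntireLFunction_rat)
    (hmodD : nonempty_modularParametrizationData)
    (hX : ClassX3Gord W 3) (hcm : ¬ W.HasCM) (hr : W.analyticRank = 0)
    (hna : Delbourgo2002.ReductionNonAnomalous W 3)
    (hMC : ∀ (V : WeierstrassCurve ℚ) [V.IsElliptic] [V.IsGloballyMinimal],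
      (∃ C : VariableChange ℚ, C • V.quadraticTwist (-3 : ℚ) = W) → X3BranchMainConjectureAt V 3) :
    BSDp W 3 :=
  ClassX3Gord.bsdp_three_rankZero_of_cycLower_of_nonAnomalous hDel3 hW16m hDel hGZK hmod hmodD hX hcm
    hr hna (ClassX3Gord.cycLowerLeadingTermAt_three_of_forall_x3BranchMainConjecture hmod hmodD hX hMC)

/-- **THE ROW'S CONSUMER on X3♯(G-ord) at `3`, `r_an = 0`, non-CM, non-anomalous**: Wuthrich 2014
Thm. 16 (half-eigen at `p = 3`, `hW16`; minus-eigen at `3`, `hW16m`) ∧ Greenberg–Vatsal ON THE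
`ω`-BRANCH for every twist model `E ⊗ χ_{−3}` (TYPED, OPEN) ∧ the analytic `μ`-certificate for every
twist model ⟹ `BSDp W 3`, everything else PUBLISHED (`hDel3 hDel hGZK hmod hmodD`).
[cite: GreenbergVatsal2000, Thm. (1.3) and p. 4] [cite: Wuthrich2014, Thm. 16 (p. 397)]
[cite: Delbourgo2002, Theorem (A), (B) (p. 40)] [cite: Delbourgo1998, Prop. 4 (p. 144)] -/
theorem ClassX3Gord.bsdp_three_rankZero_of_forall_x3BranchLambdaEq_of_muZero_of_nonAnomalous
    [Fact (Nat.Prime 3)] (hW16 : Wuthrich2014.thm16_halfEigenCharIdeal_dvd_cyclotomicPrime)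
    (hDel3 : Delbourgo2002.mainTheorem_three)
    (hW16m : Wuthrich2014.thm16_minusEigenCharIdeal_dvd_cyclotomicThree)
    (hDel : Delbourgo1998.prop4_rankZero_pow_dvd_constantCoeff)
    (hGZK : rank_eq_analyticRank_of_analyticRank_le_one) (hmod : hasEntireLFunction_rat)
    (hmodD : nonempty_modularParametrizationData)
    (hX : ClassX3Gord W 3) (hcm : ¬ W.HasCM) (hr : W.analyticRank = 0)
    (hna : Delbourgo2002.ReductionNonAnomalous W 3)
    (hlam : ∀ (V : WeierstrassCurve ℚ) [V.IsElliptic] [V.IsGloballyMinimal],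
      (∃ C : VariableChange ℚ, C • V.quadraticTwist (-3 : ℚ) = W) → X3BranchLambdaEqAt V 3)
    (hμ : ∀ (V : WeierstrassCurve ℚ) [V.IsElliptic] [V.IsGloballyMinimal],
      (∃ C : VariableChange ℚ, C • V.quadraticTwist (-3 : ℚ) = W) → X3BranchAnalyticMuZeroAt V 3) :
    BSDp W 3 :=
  ClassX3Gord.bsdp_three_rankZero_of_forall_x3BranchMainConjecture_of_nonAnomalous hDel3 hW16m hDel hGZK
    hmod hmodD hX hcm hr hna
    fun V _ _ hVW ↦ x3BranchMainConjectureAt_of_lambdaEq_of_muZero hW16 (hlam V hVW) (hμ V hVW)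

/-- **THE ROW'S CONSUMER on X3♯(M) at `3`, `r_an = 0`** (the twist spelled with the literal `-3`):
`hW16` ∧ GV on the `ω`-branch ∧ the `μ`-certificate, for every twist model ⟹ `BSDp W 3`.
[cite: GreenbergVatsal2000, Thm. (1.3) and p. 4] [cite: Wuthrich2014, Thm. 16 (p. 397)]
[cite: Delbourgo1998, Prop. 4 (p. 144)] -/
theorem ClassX3M.bsdp_three_rankZero_of_forall_x3BranchLambdaEq_of_muZero [Fact (Nat.Prime 3)]
    (hDel : Delbourgo1998.prop4_rankZero_pow_dvd_constantCoeff)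
    (hDelX : Delbourgo1998.prop4_rankZero_constantCoeff_eq_unit_mul_of_potMult)
    (hGZK : rank_eq_analyticRank_of_analyticRank_le_one) (hmod : hasEntireLFunction_rat)
    (hmodD : nonempty_modularParametrizationData)
    (hW16 : Wuthrich2014.thm16_halfEigenCharIdeal_dvd_cyclotomicPrime)
    (hX : ClassX3M W 3) (hr : W.analyticRank = 0)
    (hlam : ∀ (V : WeierstrassCurve ℚ) [V.IsElliptic] [V.IsGloballyMinimal],
      (∃ C : VariableChange ℚ, C • V.quadraticTwist (-3 : ℚ) = W) → X3BranchLambdaEqAt V 3)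
    (hμ : ∀ (V : WeierstrassCurve ℚ) [V.IsElliptic] [V.IsGloballyMinimal],
      (∃ C : VariableChange ℚ, C • V.quadraticTwist (-3 : ℚ) = W) → X3BranchAnalyticMuZeroAt V 3) :
    BSDp W 3 := by
  have h3 : ((-1 : ℚ) ^ (3 / 2) * ((3 : ℕ) : ℚ)) = -3 := by norm_num
  refine ClassX3M.bsdp_rankZero_of_x3BranchMainConjecture_odd hDel hDelX hGZK hmod hmodD hW16 hX
    (by norm_num) hr fun V _ _ hVW ↦ ?_
  have hVW' : ∃ C : VariableChange ℚ, C • V.quadraticTwist (-3 : ℚ) = W := by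
    obtain ⟨C, hC⟩ := hVW
    exact ⟨C, by rwa [h3] at hC⟩
  exact x3BranchMainConjectureAt_of_lambdaEq_of_muZero hW16 (hlam V hVW') (hμ V hVW')

end Summit.BirchSwinnertonDyer.Rank1Residual.Additive

end
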